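import Summits.AtomisticToContinuum.Crystallization.Theorems.PricedLinkCensusLocalToGlobalPhaseGapDefs
import Summits.AtomisticToContinuum.Crystallization.Theorems.PricedLinkCensusLocalToGlobalPeriodicPhaseGapOfQcg
import Summits.AtomisticToContinuum.Crystallization.Theorems.PricedLinkCensusLocalToGlobalQcgOfEventually
import Summits.AtomisticToContinuum.Crystallization.Theorems.PricedLinkCensusLocalToGlobalZeroChargeBulkOfQcg
import Summits.AtomisticToContinuum.Crystallization.Theorems.PricedLinkCensusLocalToGlobalSparsePricingForms

/-!
# Line `phase-gap-rate-upgrade` — skeleton for crux `PricedLinkCensus.LocalToGlobal`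
# (item stmt-AtomisticToContinuum-14232; lead c12, revision 2, 2026-08-17)

Crux (fixed, the route's): `LocalToGlobal : TruncatedCensusGap → ChargedEnergyGap`.

Revision 2 (lead c12, after wave 1): same two registered stubs as revision 1; ALL glue is now imported from landed
Theorems files of this line instead of being inlined —
`PricedLinkCensusLocalToGlobalPhaseGapDefs.lean` (p142662: vocabulary `PhaseGapWith` / `QualitativeChargeGapWith` /
`SparsePricingWith` / `PeriodicPhaseGapWith` / `QualitativeChargeGapEventuallyWith`; composition `localToGlobal_of_subs`;
CEG ⇒ Sub₁; lossless split `chargedEnergyGap_iff_qualitativeChargeGap_and_sparsePricing`; bookkeeping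
`chargedEnergyGap_of_qualitativeChargeGap_of_sparsePricing`; `qualitativeChargeGap_of_periodicPhaseGap`),
`…PeriodicPhaseGapOfQcg.lean` (p143541: the converse, hence `qualitativeChargeGap_iff_periodicPhaseGap`),
`…QcgOfEventually.lean` (p143226: `qualitativeChargeGap_iff_eventually` — the small-`N` regime of Sub₁ is automatic),
`…ZeroChargeBulkOfQcg.lean` (p143248: the ROUTE TARGET `ZeroChargeBulk` from Sub₁ alone, and from the periodic stub),
`…SparsePricingForms.lean` (p143853: the allowance `C·N^(2/3)` and finite-`N` exemptions are not load-bearing in the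
sparse class; `sparse_not_dense`: Sub₁ never fires on a sparse configuration), and — proposed p144258 —
`…RouteFromPhaseGap.lean` (`crystallization_of_qualitativeChargeGap : Sub₁ → SoftLayerPropagation → StackingHinge →
Crystallization`: the whole ROUTE closes from Sub₁ without any priced gap or census crux).

Registered stubs (revision 1, unchanged):
* `stub_periodicPhaseGap` (OPEN, held by the lead) — the PERIODIC PHASE GAP at tolerance `1/100`; EQUIVALENT to Sub₁
  (`qualitativeChargeGap_iff_periodicPhaseGap_hundredth`) and to Sub₁'s eventually-in-`N` form; it is the qualitative
  energetic phase comparison for Lennard-Jones in `d = 3` — crux-sized (the strategist's Sub₁ / child 1 of the armed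
  route split), the floor shared by every route on the board.
* `stub_sparsePricing` (OPEN; wave-1 worker W1: `stub-blocked`) — SPARSE PRICING IN NEAR-MINIMISERS given Sub₁;
  EQUIVALENT to revision 0's `Sub₁ → ChargedEnergyGap`; inside the sparse class Sub₁ is inert (`sparse_not_dense`), so
  the stub is the sibling crux 14231 restricted to sparse near-minimisers, and every localisation of it consumes
  SoftLayerPropagation (14233, open) + uniform Barlow coercivity (14231's `stub_barlowCoercivity`, open) + a linear
  floor on 3 %-charged cores (`stub_coarseGap`, open).  The ROUTE does not need it (`zeroChargeBulk_of_…`,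
  `crystallization_of_qualitativeChargeGap`).

Composition: `LocalToGlobal_of : LocalToGlobal := fun _ => stub_qualitativeToPricedGap stub_qualitativeChargeGap`, the
rev-0 stubs being DERIVED: `stub_qualitativeChargeGap` from `stub_periodicPhaseGap` by far periodisation,
`stub_qualitativeToPricedGap` from `stub_sparsePricing` by the landed bookkeeping; the only `sorry`s are the two stubs.

Disproof used (`Cruxes/LocalToGlobal/Disproof.lean`, gen 2, unchanged since 2026-08-16T05:22Z, no `-- Targets`):
§1 fold (inlined); §3 injectivity kept; D1/D2/§4–§6, N1–N4 concern consumptions of `TruncatedCensusGap`, not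
attempted (the antecedent is discarded).  Kill criteria of the periodic stub: the landed
`not_chargedEnergyGap_of_forall_charged_near`-type lemmas at FIXED charged fraction (record: every charged periodic
competitor ≥ 2e−2 above hcp, kit j020790 / j022240 / j022644 / j022675 — no alarm).
-/

noncomputable section

namespace Summit.AtomisticToContinuum.Crystallization.Cruxes.LocalToGlobal.PhaseGapRateUpgrade

open Literature.MathematicalPhysics.StatisticalMechanics
open Literature.Geometry.DiscreteGeometry
open Summit.AtomisticToContinuum.Crystallization.Theses.PricedLinkCensus
open Summit.AtomisticToContinuum.Crystallization.Theorems.ChargedEnergyGapNegative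
open Summit.AtomisticToContinuum.Crystallization.Theorems.PricedLinkCensusLocalToGlobalPhaseGap
open scoped BigOperators

/-! ## Stub A — the PERIODIC PHASE GAP (open; held by the lead) -/

/-- STUB (open, held by the lead; the floor of the crux and of the route — phase comparison in `d = 3`, qualitative,
periodic form; `= PeriodicPhaseGapWith (1/100)` by `Iff.rfl`): for every `ρ > 0` there is `g > 0` such that every
periodic configuration of `ℝ³` whose motif has charged fraction at least `ρ` at tolerance `1/100` has Lennard-Jones
energy per particle `≥ e* + g`.  Kill: a densely charged periodic configuration within `o(1)` of `e*`. -/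
theorem stub_periodicPhaseGap :
    ∀ ρ : ℝ, 0 < ρ → ∃ g : ℝ, 0 < g ∧ ∀ Q : PeriodicConfiguration 3,
      ρ ≤ chargedFraction (1 / 100) Q → eStar + g ≤ Q.energyPerParticle lennardJones := by
  sorry

/-! ## Stub B — SPARSE PRICING in near-minimisers, given the phase gap (open; W1 blocked) -/

/-- STUB (open; wave-1 worker W1 replied `stub-blocked`: inside the sparse class the hypothesis Sub₁ is inert —
`sparse_not_dense` — so this is 14231 restricted to sparse near-minimisers, consuming SoftLayerPropagation (14233),
uniform Barlow coercivity and a 3 %-core floor, all open): GIVEN Sub₁, there are `ρ₁, κ > 0` and `C` such that every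
injective `y` with `#ch ≤ ρ₁·N` and `E_LJ(y) ≤ N·(e* + ρ₁)` has `N·e* + κ·#ch − C·N^{2/3} ≤ E_LJ(y)`
(`= QualitativeChargeGapWith (1/100) → SparsePricingWith (1/100)`; the allowance may be taken `0`,
`stub_sparsePricing_iff_noAllowance`).  Kill: ever-milder charge-creating defects of near-optimal Barlow hosts with
cost per charged site → 0 (binding known species: the 1 % threshold pinch at ≈ 4e−5 per site, which does not → 0). -/
theorem stub_sparsePricing :
    (∀ ρ : ℝ, 0 < ρ → ∃ g : ℝ, 0 < g ∧ ∀ (N : ℕ) (y : Fin N → EuclideanSpace ℝ (Fin 3)),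
      Function.Injective y →
        ρ * (N : ℝ) ≤ (Nat.card {i : Fin N // ¬ Literature.Geometry.DiscreteGeometry.IsChargeFree
            (1 / 100 : ℝ) y i} : ℝ) →
          (N : ℝ) * ((⨅ Q : Literature.MathematicalPhysics.StatisticalMechanics.PeriodicConfiguration 3,
              Q.energyPerParticle Literature.MathematicalPhysics.StatisticalMechanics.lennardJones) + g) ≤
            Literature.MathematicalPhysics.StatisticalMechanics.interactionEnergy
              Literature.MathematicalPhysics.StatisticalMechanics.lennardJones y) →
    ∃ ρ₁ κ C : ℝ, 0 < ρ₁ ∧ 0 < κ ∧ ∀ (N : ℕ) (y : Fin N → EuclideanSpace ℝ (Fin 3)),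
      Function.Injective y →
        (Nat.card {i : Fin N // ¬ Literature.Geometry.DiscreteGeometry.IsChargeFree (1 / 100 : ℝ) y i} : ℝ) ≤
            ρ₁ * (N : ℝ) →
          Literature.MathematicalPhysics.StatisticalMechanics.interactionEnergy
              Literature.MathematicalPhysics.StatisticalMechanics.lennardJones y ≤
            (N : ℝ) * ((⨅ Q : Literature.MathematicalPhysics.StatisticalMechanics.PeriodicConfiguration 3,
              Q.energyPerParticle Literature.MathematicalPhysics.StatisticalMechanics.lennardJones) + ρ₁) →
          (N : ℝ) * (⨅ Q : Literature.MathematicalPhysics.StatisticalMechanics.PeriodicConfiguration 3,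
              Q.energyPerParticle Literature.MathematicalPhysics.StatisticalMechanics.lennardJones) +
              κ * (Nat.card {i : Fin N // ¬ Literature.Geometry.DiscreteGeometry.IsChargeFree
                (1 / 100 : ℝ) y i} : ℝ) - C * (N : ℝ) ^ (2 / 3 : ℝ) ≤
            Literature.MathematicalPhysics.StatisticalMechanics.interactionEnergy
              Literature.MathematicalPhysics.StatisticalMechanics.lennardJones y := by
  sorry

/-! ## The stubs read through the landed vocabulary (all `Iff.rfl`) -/

/-- Stub A is `PeriodicPhaseGapWith (1/100)`. -/
theorem stub_periodicPhaseGap_iff :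
    (∀ ρ : ℝ, 0 < ρ → ∃ g : ℝ, 0 < g ∧ ∀ Q : PeriodicConfiguration 3,
      ρ ≤ chargedFraction (1 / 100) Q → eStar + g ≤ Q.energyPerParticle lennardJones) ↔
      PeriodicPhaseGapWith (1 / 100) :=
  Iff.rfl

/-- Stub A as a term of the vocabulary. -/
theorem periodicPhaseGap_hundredth : PeriodicPhaseGapWith (1 / 100) := stub_periodicPhaseGap

/-- Stub B as a term of the vocabulary: `Sub₁ → SparsePricingWith (1/100)`. -/
theorem sparsePricing_of_qualitativeChargeGap :
    QualitativeChargeGapWith (1 / 100) → SparsePricingWith (1 / 100) := stub_sparsePricing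

/-! ## Revision 0's stubs, DERIVED from the registered ones through landed theorems -/

/-- Sub₁, the QUALITATIVE PHASE GAP (revision 0's `stub_qualitativeChargeGap`, statement unchanged): from stub A by
far periodisation (`qualitativeChargeGap_of_periodicPhaseGap`, p142662). -/
theorem stub_qualitativeChargeGap :
    ∀ ρ : ℝ, 0 < ρ → ∃ g : ℝ, 0 < g ∧ ∀ (N : ℕ) (y : Fin N → EuclideanSpace ℝ (Fin 3)),
      Function.Injective y →
        ρ * (N : ℝ) ≤ (Nat.card {i : Fin N // ¬ Literature.Geometry.DiscreteGeometry.IsChargeFree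
            (1 / 100 : ℝ) y i} : ℝ) →
          (N : ℝ) * ((⨅ Q : Literature.MathematicalPhysics.StatisticalMechanics.PeriodicConfiguration 3,
              Q.energyPerParticle Literature.MathematicalPhysics.StatisticalMechanics.lennardJones) + g) ≤
            Literature.MathematicalPhysics.StatisticalMechanics.interactionEnergy
              Literature.MathematicalPhysics.StatisticalMechanics.lennardJones y :=
  (qualitativeChargeGapWith_iff_stub).1 (qualitativeChargeGap_of_periodicPhaseGap (by norm_num) periodicPhaseGap_hundredth)

/-- Sub₂, the RATE UPGRADE (revision 0's `stub_qualitativeToPricedGap`, statement unchanged): from stub B by the landed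
bookkeeping `chargedEnergyGap_of_qualitativeChargeGap_of_sparsePricing` (p142662). -/
theorem stub_qualitativeToPricedGap :
    (∀ ρ : ℝ, 0 < ρ → ∃ g : ℝ, 0 < g ∧ ∀ (N : ℕ) (y : Fin N → EuclideanSpace ℝ (Fin 3)),
      Function.Injective y →
        ρ * (N : ℝ) ≤ (Nat.card {i : Fin N // ¬ Literature.Geometry.DiscreteGeometry.IsChargeFree
            (1 / 100 : ℝ) y i} : ℝ) →
          (N : ℝ) * ((⨅ Q : Literature.MathematicalPhysics.StatisticalMechanics.PeriodicConfiguration 3,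
              Q.energyPerParticle Literature.MathematicalPhysics.StatisticalMechanics.lennardJones) + g) ≤
            Literature.MathematicalPhysics.StatisticalMechanics.interactionEnergy
              Literature.MathematicalPhysics.StatisticalMechanics.lennardJones y) →
    ChargedEnergyGap :=
  fun h => chargedEnergyGap_of_qualitativeChargeGap_of_sparsePricing
    ((qualitativeChargeGapWith_iff_stub).2 h) (sparsePricing_of_qualitativeChargeGap ((qualitativeChargeGapWith_iff_stub).2 h))

/-! ## The composition: the stubs prove the crux BY NAME -/

/-- **Skeleton theorem** (the one `skeleton check` audits): the crux `LocalToGlobal` BY NAME — the rate upgrade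
applied to the phase gap gives `ChargedEnergyGap`, and the antecedent `TruncatedCensusGap` is discarded (the fold
`localToGlobal_of_chargedEnergyGap`, p116082, inlined).  `sorry` occurs only inside `stub_periodicPhaseGap` and
`stub_sparsePricing`. -/
theorem LocalToGlobal_of : LocalToGlobal :=
  fun _hT => stub_qualitativeToPricedGap stub_qualitativeChargeGap

/-! ## What the stubs give the ROUTE (landed consequences, modulo stub A only) -/

/-- The route target `ZeroChargeBulk` needs stub A only (`zeroChargeBulk_of_periodicPhaseGap`, p143248). -/
theorem zeroChargeBulk_of_stubA : ZeroChargeBulk := zeroChargeBulk_of_periodicPhaseGap periodicPhaseGap_hundredth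

/-- Sub₁ in all three landed equivalent forms, from stub A. -/
theorem qualitativeChargeGap_forms_of_stubA :
    QualitativeChargeGapWith (1 / 100) ∧ PeriodicPhaseGapWith (1 / 100) ∧ QualitativeChargeGapEventuallyWith (1 / 100) :=
  ⟨qualitativeChargeGap_of_periodicPhaseGap (by norm_num) periodicPhaseGap_hundredth, periodicPhaseGap_hundredth,
    (qualitativeChargeGap_iff_eventually (1 / 100)).1
      (qualitativeChargeGap_of_periodicPhaseGap (by norm_num) periodicPhaseGap_hundredth)⟩

end Summit.AtomisticToContinuum.Crystallization.Cruxes.LocalToGlobal.PhaseGapRateUpgrade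

end
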